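import Mathlib
import Summits.HodgeConjecture.HodgeConjecture.Theorems.PadicSemiregularLiftHodgeAbelianVarietiesAndrePowerHOne

/-!
# Crux `HodgeAbelianVarieties` (stmt-HodgeConjecture-1333), line `cm-pivot-andre` — André with CM targets, module L3f: splitting the single-embedding component along the idempotents `u_α`

Setting (`work/andre/PLAN.md` §7): `Y = θ` diagonal on the line basis `𝔅(λ,s)` of `H¹(B)` (eigenvalues `ρ_s`,
distinct), the wedge basis `Bw` of `Hᵈ(B)` with its product formula, the idempotents `u_α` with
`u_α^* 𝔅(λ,s) = N·[e_s⁻¹ λ ∈ α]·𝔅(λ,s)` (module L2b). For a class `y ∈ Hᵈ(B)` let `y_D` be its component on the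
single-embedding monomials (the joint zero pattern of the rational operators `R_k`, characterised by the constant-
multiset criterion). Then: (i) `Σ_{|α| = d} N^{-d} u_α^* y_D = y_D` (each single-embedding monomial `Bw S`,
`S ⊆ Fin N × {s}`, is fixed by exactly one `N^{-d} u_α^*`, `α = e_s⁻¹(pr₁ S)`, and killed by the others);
(ii) `u_α^* u_α^* = N^d u_α^*` on `Hᵈ(B)`; (iii) each `u_α^* y_D` splits as `Σ_s w_s` with
`(x•𝟙 + y•Y)^* w_s = (x + y ρ_s)^d w_s` — the Weil eigen-condition of André's classes on the targets.
-/

set_option linter.dupNamespace false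

noncomputable section

namespace Summit.HodgeConjecture.HodgeConjecture.Theorems.HodgeAbelianVarieties.CMPivotAndre

open CategoryTheory
open Literature.AlgebraicGeometry Literature.AlgebraicGeometry.Motives Literature.AlgebraicGeometry.HodgeTheory

/-- **Splitting the single-embedding component along André's idempotents.** See the module docstring: with all
structure passed as hypotheses, for every `y ∈ Hᵈ(B(ℂ); ℂ)` with single-embedding component `y_D`:
`Σ_{|α|=d} N^{-d} • u_α^* y_D = y_D`; `u_α^* (u_α^* z) = N^d • u_α^* z` for all `z`; and each `u_α^* y_D` is a sum
over `s` of classes `w_s` with `(x•𝟙 + y•Y)^* w_s = (x + y ρ_s)^d • w_s` for all `x y : ℕ`.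
[cite: Andre1992HodgeCM, Théorème] [cite: Deligne1982HodgeCycles, §4 (4.4)] -/
theorem andre_idempotentSplit : ∀ {N n d : ℕ} (B : Literature.AlgebraicGeometry.Motives.AbelianVariety ℂ) (Y : B ⟶ B) (𝔅 : Module.Basis (Fin N × Fin n) ℂ (Literature.AlgebraicGeometry.HodgeTheory.complexBetti B.X 1)) (ρ : Fin n → ℂ) (Bw : Module.Basis (Set.powersetCard (Fin N × Fin n) d) ℂ (Literature.AlgebraicGeometry.HodgeTheory.complexBetti B.X d)) (e : Fin n → Equiv.Perm (Fin N)) (Nd : ℕ) (u : Finset (Fin N) → (B ⟶ B)), 0 < d → 0 < Nd → Function.Injective ρ → (∀ l s, Literature.AlgebraicGeometry.HodgeTheory.complexBetti.map Y.hom.hom.hom 1 (𝔅 (l, s)) = ρ s • 𝔅 (l, s)) → (∀ (f : B ⟶ B) (a : Fin N × Fin n → ℂ), (∀ i, Literature.AlgebraicGeometry.HodgeTheory.complexBetti.map f.hom.hom.hom 1 (𝔅 i) = a i • 𝔅 i) → ∀ S, Literature.AlgebraicGeometry.HodgeTheory.complexBetti.map f.hom.hom.hom d (Bw S) = (∏ i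 ∈ (S : Finset (Fin N × Fin n)), a i) • Bw S) → (∀ α l s, Literature.AlgebraicGeometry.HodgeTheory.complexBetti.map (u α).hom.hom.hom 1 (𝔅 (l, s)) = (if (e s).symm l ∈ α then (Nd : ℂ) else 0) • 𝔅 (l, s)) → (∀ M : Multiset ℂ, M.card = d → ((∀ k : ℕ, k ≤ d → (d : ℂ) ^ k * M.esymm k = (d.choose k : ℂ) * M.esymm 1 ^ k) ↔ ∃ r : ℂ, M = Multiset.replicate d r)) → ∀ y : Literature.AlgebraicGeometry.HodgeTheory.complexBetti B.X d, (∑ α ∈ (Finset.univ : Finset (Fin N)).powersetCard d, ((Nd : ℂ) ^ d)⁻¹ • Literature.AlgebraicGeometry.HodgeTheory.complexBetti.map (u α).hom.hom.hom d (∑ S ∈ Finset.univ.filter (fun S : Set.powersetCard (Fin N × Fin n) d => ∀ k : Fin (d + 1), (d : ℂ) ^ (k : ℕ) * (((S : Finset (Fin N × Fin n)).val.map fun i => ρ i.2).esymm k) - (d.choose k : ℂ) * (((S : Finset (Fin N × Fin n)).val.map fun i => ρ i.2).esymm 1) ^ (k : ℕ) = 0), Bw.repr y S • Bw S) = ∑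 S ∈ Finset.univ.filter (fun S : Set.powersetCard (Fin N × Fin n) d => ∀ k : Fin (d + 1), (d : ℂ) ^ (k : ℕ) * (((S : Finset (Fin N × Fin n)).val.map fun i => ρ i.2).esymm k) - (d.choose k : ℂ) * (((S : Finset (Fin N × Fin n)).val.map fun i => ρ i.2).esymm 1) ^ (k : ℕ) = 0), Bw.repr y S • Bw S) ∧ (∀ α (z : Literature.AlgebraicGeometry.HodgeTheory.complexBetti B.X d), Literature.AlgebraicGeometry.HodgeTheory.complexBetti.map (u α).hom.hom.hom d (Literature.AlgebraicGeometry.HodgeTheory.complexBetti.map (u α).hom.hom.hom d z) = ((Nd : ℂ) ^ d) • Literature.AlgebraicGeometry.HodgeTheory.complexBetti.map (u α).hom.hom.hom d z) ∧ (∀ α, ∃ w : Fin n → Literature.AlgebraicGeometry.HodgeTheory.complexBetti B.X d, Literature.AlgebraicGeometry.HodgeTheory.complexBetti.map (u α).hom.hom.hom d (∑ S ∈ Finset.univ.filter (fun S : Set.powersetCard (Fin N × Fin n) d => ∀ k : Fin (d + 1), (d : ℂ) ^ (k : ℕ) * (((S : Finset (Fin N × Fin n)).val.map fun i => ρ i.2).esymm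 k) - (d.choose k : ℂ) * (((S : Finset (Fin N × Fin n)).val.map fun i => ρ i.2).esymm 1) ^ (k : ℕ) = 0), Bw.repr y S • Bw S) = ∑ s, w s ∧ ∀ (s : Fin n) (x y' : ℕ), Literature.AlgebraicGeometry.HodgeTheory.complexBetti.map (x • 𝟙 B + y' • Y).hom.hom.hom d (w s) = (((x : ℂ) + (y' : ℂ) * ρ s) ^ d) • w s) := by
  intro N n d B Y 𝔅 ρ Bw e Nd u hd hNd hρ hY hBw hu hcrit y
  classical
  -- abbreviations
  let rval : ℕ → Multiset ℂ → ℂ := fun k M => (d : ℂ) ^ k * M.esymm k - (d.choose k : ℂ) * M.esymm 1 ^ k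
  let MS : Set.powersetCard (Fin N × Fin n) d → Multiset ℂ := fun S =>
    ((S : Finset (Fin N × Fin n)).val.map fun i => ρ i.2)
  let Dp : Set.powersetCard (Fin N × Fin n) d → Prop := fun S => ∀ k : Fin (d + 1), rval k (MS S) = 0
  let F : Finset (Set.powersetCard (Fin N × Fin n) d) := Finset.univ.filter fun S => Dp S
  let single : Set.powersetCard (Fin N × Fin n) d → Fin n → Prop := fun S s =>
    ∀ i ∈ (S : Finset (Fin N × Fin n)), i.2 = s
  set yD : complexBetti B.X d := ∑ S ∈ F, Bw.repr y S • Bw S with hyD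
  show (∑ α ∈ (Finset.univ : Finset (Fin N)).powersetCard d,
      ((Nd : ℂ) ^ d)⁻¹ • complexBetti.map (u α).hom.hom.hom d yD = yD) ∧ _ ∧
      (∀ α, ∃ w : Fin n → complexBetti B.X d, complexBetti.map (u α).hom.hom.hom d yD = ∑ s, w s ∧ _)
  have hMScard : ∀ S, (MS S).card = d := fun S => by
    simp only [MS, Multiset.card_map, Finset.card_val, Set.powersetCard.card_eq]
  have hSne : ∀ S : Set.powersetCard (Fin N × Fin n) d, (S : Finset (Fin N × Fin n)).Nonempty := fun S => by
    rw [← Finset.card_pos, Set.powersetCard.card_eq]; exact hd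
  -- `Dp S ↔ S lies in one column`
  have hDp_iff : ∀ S, Dp S ↔ ∃ s, single S s := by
    intro S
    have h1 : Dp S ↔ ∀ k : ℕ, k ≤ d → (d : ℂ) ^ k * (MS S).esymm k = (d.choose k : ℂ) * (MS S).esymm 1 ^ k := by
      constructor
      · intro h k hk
        exact sub_eq_zero.mp (h ⟨k, Nat.lt_succ_of_le hk⟩)
      · intro h k
        exact sub_eq_zero.mpr (h k (Nat.le_of_lt_succ k.2))
    rw [h1, hcrit _ (hMScard S)]
    constructor
    · rintro ⟨r, hr⟩
      obtain ⟨i₀, hi₀⟩ := hSne S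
      refine ⟨i₀.2, fun i hi => hρ ?_⟩
      have hi' : ρ i.2 ∈ Multiset.replicate d r := by
        rw [← hr]; exact Multiset.mem_map_of_mem _ (Finset.mem_val.mpr hi)
      have hi₀' : ρ i₀.2 ∈ Multiset.replicate d r := by
        rw [← hr]; exact Multiset.mem_map_of_mem _ (Finset.mem_val.mpr hi₀)
      rw [Multiset.eq_of_mem_replicate hi', Multiset.eq_of_mem_replicate hi₀']
    · rintro ⟨s, hs⟩
      refine ⟨ρ s, ?_⟩
      have : MS S = ((S : Finset (Fin N × Fin n)).val.map fun _ => ρ s) :=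
        Multiset.map_congr rfl fun i hi => by rw [hs i (Finset.mem_val.mp hi)]
      rw [this, Multiset.map_const', Finset.card_val, Set.powersetCard.card_eq]
  have hsingle_unique : ∀ S s s', single S s → single S s' → s = s' := by
    intro S s s' hs hs'
    obtain ⟨i, hi⟩ := hSne S
    rw [← hs i hi, ← hs' i hi]
  -- the action of `u_α^*` on the wedge basis
  let aα : Finset (Fin N) → Fin N × Fin n → ℂ := fun α i => if (e i.2).symm i.1 ∈ α then (Nd : ℂ) else 0
  have hua : ∀ α i, complexBetti.map (u α).hom.hom.hom 1 (𝔅 i) = aα α i • 𝔅 i := by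
    rintro α ⟨l, s⟩; exact hu α l s
  let P : Finset (Fin N) → Set.powersetCard (Fin N × Fin n) d → ℂ := fun α S =>
    if ∀ i ∈ (S : Finset (Fin N × Fin n)), (e i.2).symm i.1 ∈ α then (Nd : ℂ) ^ d else 0
  have huBw : ∀ α S, complexBetti.map (u α).hom.hom.hom d (Bw S) = P α S • Bw S := by
    intro α S
    rw [hBw _ _ (hua α) S]
    congr 1
    simp only [aα, P, Finset.prod_ite_zero, Finset.prod_const, Set.powersetCard.card_eq]
  have hPsq : ∀ α S, P α S * P α S = (Nd : ℂ) ^ d * P α S := by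
    intro α S
    simp only [P]
    split_ifs <;> ring
  -- (ii) `u_α^* u_α^* = Nd^d u_α^*`
  have hii : ∀ α (z : complexBetti B.X d), complexBetti.map (u α).hom.hom.hom d
      (complexBetti.map (u α).hom.hom.hom d z) = ((Nd : ℂ) ^ d) • complexBetti.map (u α).hom.hom.hom d z := by
    intro α z
    conv_lhs => rw [← Bw.sum_repr z]
    conv_rhs => rw [← Bw.sum_repr z]
    simp only [map_sum, map_smul, huBw, smul_smul, Finset.smul_sum]
    refine Finset.sum_congr rfl fun S _ => ?_
    congr 1
    rw [mul_assoc, hPsq]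
    ring
  -- (i) the idempotent decomposition on `yD`
  have hPsingle : ∀ S s, single S s → ∀ α ∈ (Finset.univ : Finset (Fin N)).powersetCard d,
      P α S = if α = (S : Finset (Fin N × Fin n)).image (fun i => (e s).symm i.1) then (Nd : ℂ) ^ d else 0 := by
    intro S s hs α hα
    have hαcard : α.card = d := (Finset.mem_powersetCard.mp hα).2
    set α₀ := (S : Finset (Fin N × Fin n)).image (fun i => (e s).symm i.1) with hα₀
    have hα₀card : α₀.card = d := by
      rw [hα₀, Finset.card_image_of_injOn, Set.powersetCard.card_eq]
      rintro ⟨l₁, s₁⟩ h₁ ⟨l₂, s₂⟩ h₂ h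
      simp only at h
      have e1 : s₁ = s := hs _ h₁
      have e2 : s₂ = s := hs _ h₂
      exact Prod.ext ((e s).symm.injective h) (e1.trans e2.symm)
    have hsub : (∀ i ∈ (S : Finset (Fin N × Fin n)), (e i.2).symm i.1 ∈ α) ↔ α₀ ⊆ α := by
      constructor
      · intro h x hx
        obtain ⟨i, hi, rfl⟩ := Finset.mem_image.mp hx
        have := h i hi
        rwa [hs i hi] at this
      · intro h i hi
        have : (e s).symm i.1 ∈ α := h (Finset.mem_image.mpr ⟨i, hi, rfl⟩)
        rwa [← hs i hi] at this
    have heq : α₀ ⊆ α ↔ α = α₀ := by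
      constructor
      · intro h
        exact (Finset.eq_of_subset_of_card_le h (by rw [hαcard, hα₀card])).symm
      · rintro rfl; exact Finset.Subset.refl _
    simp only [P, hsub, heq]
  have hi : ∑ α ∈ (Finset.univ : Finset (Fin N)).powersetCard d,
      ((Nd : ℂ) ^ d)⁻¹ • complexBetti.map (u α).hom.hom.hom d yD = yD := by
    have hNd' : ((Nd : ℂ) ^ d) ≠ 0 := pow_ne_zero _ (Nat.cast_ne_zero.mpr hNd.ne')
    rw [hyD]
    simp only [map_sum, map_smul, huBw, Finset.smul_sum, smul_smul]
    rw [Finset.sum_comm]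
    refine Finset.sum_congr rfl fun S hS => ?_
    rw [← Finset.sum_smul]
    congr 1
    obtain ⟨s, hs⟩ := (hDp_iff S).mp (Finset.mem_filter.mp hS).2
    have hα₀mem : (S : Finset (Fin N × Fin n)).image (fun i => (e s).symm i.1) ∈
        (Finset.univ : Finset (Fin N)).powersetCard d := by
      rw [Finset.mem_powersetCard]
      refine ⟨Finset.subset_univ _, ?_⟩
      rw [Finset.card_image_of_injOn, Set.powersetCard.card_eq]
      rintro ⟨l₁, s₁⟩ h₁ ⟨l₂, s₂⟩ h₂ h
      simp only at h
      have e1 : s₁ = s := hs _ h₁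
      have e2 : s₂ = s := hs _ h₂
      exact Prod.ext ((e s).symm.injective h) (e1.trans e2.symm)
    rw [Finset.sum_congr rfl (fun α hα => by rw [hPsingle S s hs α hα]), ]
    simp only [mul_ite, mul_zero, Finset.sum_ite_eq', hα₀mem, if_true]
    rw [mul_comm, mul_assoc, mul_inv_cancel₀ hNd', mul_one]
  -- (iii) the column decomposition and the Weil eigen-action
  have hGY : ∀ (x y' : ℕ) (i : Fin N × Fin n),
      complexBetti.map ((x • 𝟙 B + y' • Y) : B ⟶ B).hom.hom.hom 1 (𝔅 i) = ((x : ℂ) + (y' : ℂ) * ρ i.2) • 𝔅 i := by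
    rintro x y' ⟨l, s⟩
    rw [complexBetti_map_add_one]
    change (complexBetti.map (x • 𝟙 B : B ⟶ B).hom.hom.hom 1 + complexBetti.map (y' • Y : B ⟶ B).hom.hom.hom 1).hom (𝔅 (l, s)) = _
    rw [ModuleCat.hom_add, LinearMap.add_apply, complexBetti_map_nsmul_one, complexBetti_map_nsmul_one]
    rw [ModuleCat.hom_nsmul, ModuleCat.hom_nsmul, LinearMap.smul_apply, LinearMap.smul_apply, hY]
    change x • complexBetti.map (𝟙 B : B ⟶ B).hom.hom.hom 1 (𝔅 (l, s)) + _ = _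
    rw [complexBetti_map_id_one_apply, add_smul, ← Nat.cast_smul_eq_nsmul ℂ, ← Nat.cast_smul_eq_nsmul ℂ, smul_smul]
  have hGBw : ∀ (x y' : ℕ) S s, single S s → complexBetti.map ((x • 𝟙 B + y' • Y) : B ⟶ B).hom.hom.hom d (Bw S) =
      (((x : ℂ) + (y' : ℂ) * ρ s) ^ d) • Bw S := by
    intro x y' S s hs
    rw [hBw _ _ (hGY x y') S]
    congr 1
    rw [Finset.prod_congr rfl (fun i hi => by rw [hs i hi]), Finset.prod_const, Set.powersetCard.card_eq]
  have hiii : ∀ α, ∃ w : Fin n → complexBetti B.X d, complexBetti.map (u α).hom.hom.hom d yD = ∑ s, w s ∧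
      ∀ (s : Fin n) (x y' : ℕ), complexBetti.map (x • 𝟙 B + y' • Y).hom.hom.hom d (w s) =
        (((x : ℂ) + (y' : ℂ) * ρ s) ^ d) • w s := by
    intro α
    refine ⟨fun s => ∑ S ∈ F.filter (fun S => single S s), (P α S * Bw.repr y S) • Bw S, ?_, ?_⟩
    · rw [hyD]
      simp only [map_sum, map_smul, huBw, smul_smul]
      rw [show (∑ s : Fin n, ∑ S ∈ F.filter (fun S => single S s), (P α S * Bw.repr y S) • Bw S) =
          ∑ s : Fin n, ∑ S ∈ F, if single S s then (P α S * Bw.repr y S) • Bw S else 0 from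
        Finset.sum_congr rfl fun s _ => Finset.sum_filter _ _, Finset.sum_comm]
      refine Finset.sum_congr rfl fun S hS => ?_
      obtain ⟨s, hs⟩ := (hDp_iff S).mp (Finset.mem_filter.mp hS).2
      rw [Finset.sum_eq_single s, if_pos hs, mul_comm]
      · intro s' _ hs'
        rw [if_neg]
        intro h
        exact hs' (hsingle_unique S s' s h hs)
      · intro h; exact absurd (Finset.mem_univ s) h
    · intro s x y'
      rw [map_sum, Finset.smul_sum]
      refine Finset.sum_congr rfl fun S hS => ?_
      have hs : single S s := (Finset.mem_filter.mp hS).2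
      rw [map_smul, hGBw x y' S s hs, smul_comm]
  exact ⟨hi, hii, hiii⟩

end Summit.HodgeConjecture.HodgeConjecture.Theorems.HodgeAbelianVarieties.CMPivotAndre

end
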